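import Summits.HodgeConjecture.HodgeConjecture.Theorems.Ring2WeilCoverageRealUnitNormReduction
import Summits.HodgeConjecture.HodgeConjecture.Theorems.Ring2WeilCoverageCMTypeSetChineseRemainder
import Mathlib.GroupTheory.OrderOfElement
import HarnessLib

/-!
# Weil-type family coverage — HALF-SYSTEMS OF POWERS AND THE NORM OF `ℚ(ζₙ)⁺` READ ON A HALF-SYSTEM: the tools for
# the CONVERSE of THEOREM L (i) (units of norm `−1` at the exceptional levels `2^a`, `p^a`, `2p^a`)

research route conditional on HC_CM; not a corollary; Q11.4-sentence-2 already refuted in dim ≥ 3.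

Ring 2, WEIL-TYPE FAMILY-COVERAGE CENSUS (`HOME/WEIL-FAMILY-COVERAGE.md` `## b01`, block b01.45; owner ring2-b01), part 71
of the `Ring2WeilCoverage*` series.  Parts 66/67/68 proved THEOREM L (i) — «no unit of `ℚ(ζₙ)⁺` has norm `−1`» — at
every level `n ∉ {2^a, p^a, 2p^a}` and left the converse («at the exceptional levels such a unit EXISTS») NOT CLAIMED
(census b01.44 (E)).  Parts 72/73 prove the converse; this file supplies the two tools they share:

* §1 **half-systems by counting** (`isCMTypeSet_of_card`: a set `T` of unit residues mod `m` with `T ∩ (−T) = ∅` and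
  `2·|T| = φ(m)` is a CM type set) and **half-systems of powers** (`isCMTypeSet_image_pow`: `{γ^i : i < d}` for a unit
  `γ` mod `m` with `d ≤ ord γ`, `2d = φ(m)` and `γ^i ≠ −γ^j` for `i, j < d` — e.g. a generator of a cyclic `(ℤ/m)ˣ`
  with `2d = φ(m)`, or `γ = 5` mod `2^a` with `d = 2^{a−2}`);
* §2 **the norm of `K⁺ = ℚ(ζₙ)⁺` read on a half-system** (`algebraMap_norm_eq_prod_aut`:
  `N_{K⁺/ℚ}(x) = ∏_{t ∈ T} σ_t(x)` in `K` for `x ∈ K⁺` and any CM type set `T`, `σ_t : ζ ↦ ζ^t` — part 55's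
  `∏_{φ ∈ Φ} φ(x) = N(x)` for the CM type `Φ` reading `T` and part 62's `∏_Φ φ = φ₁ ∘ ∏_T σ_t`), and the DESCENT
  `exists_units_norm_eq_neg_one_of_prod_aut`: a unit `U` of `𝓞 K` fixed by complex conjugation with
  `∏_{t ∈ T} σ_t(U) = −1` is (the image of) a unit of `𝓞 K⁺` of norm `−1` (Mathlib
  `IsCMField.Units.complexConj_eq_self_iff`);
* §3 small lemmas on `ζ`: `complexConj K ζ = ζ⁻¹`, and the telescoping identity `∏_{i<d} f(i+1)/f(i) = f(d)/f(0)` in a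
  field.

HONEST FRAMING: elementary algebraic number theory (`Gal(ℚ(ζₙ)/ℚ) = (ℤ/n)ˣ`, complex conjugation `= σ_{−1}`); nothing
here is a statement about Hodge classes, `W_K`, general members or HC; `HC_CM` is used nowhere.  No `def`, no named
fact, no `sorry`.

References: [cite: Washington1997, §2, Thm. 2.5 and §8.1]; [cite: Garbanati1976UnitsNormMinusOne] (background);
census b01.44 (E), b01.45.
-/

noncomputable section

open scoped Classical nonZeroDivisors NumberField
open NumberField Module Finset

namespace Summit.HodgeConjecture.Ring2WeilCoverage.RealUnitNormHalfSystems

open Literature.AlgebraicGeometry.Motives (CMType)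
open Literature.AlgebraicGeometry.HodgeTheory (IsCMTypeSet)
open Literature.AlgebraicGeometry.ComplexMultiplication.CyclotomicCMType
  (exists_embedding_apply_eq_toCircle exists_cmType_iff_mem)
open Summit.HodgeConjecture.Ring2WeilCoverage.CMUnitSignature (prod_embedding_algebraMap_eq_norm)
open Summit.HodgeConjecture.Ring2WeilCoverage.CMTypeSetPairCount (coprime_val_neg)
open Summit.HodgeConjecture.Ring2WeilCoverage.CMTypeSetChineseRemainder (coprime_iff_isUnit card_image_units)
open Summit.HodgeConjecture.Ring2WeilCoverage.RealUnitNormReduction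
  (exists_aut_apply_eq_pow prod_embedding_eq_prod_aut coe_algebraMap_realIntegers)

/-! ### §1 Half-systems by counting, and half-systems of powers of one unit residue -/

section HalfSystems

variable {m : ℕ} [NeZero m]

/-- **A CM type set by counting**: a set `T` of unit residues mod `m` which never contains `t` and `−t` together
and has `2·|T| = φ(m)` elements contains exactly one of `t, −t` for EVERY unit residue `t` (`T ⊔ (−T)` has `φ(m)`
elements, hence is all of `(ℤ/m)ˣ`).
research route conditional on HC_CM; not a corollary; Q11.4-sentence-2 already refuted in dim ≥ 3. [folklore] -/
theorem isCMTypeSet_of_card {T : Finset (ZMod m)} (hu : ∀ t ∈ T, t.val.Coprime m)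
    (hdisj : ∀ t ∈ T, -t ∉ T) (hcard : 2 * T.card = Nat.totient m) : IsCMTypeSet m T := by
  refine ⟨hu, fun t ht => ⟨fun h => hdisj t h, fun hnt => ?_⟩⟩
  by_contra htT
  -- `T ⊔ (−T) ⊆ units ∖ {t}` has `φ(m)` elements: one too many
  set U : Finset (ZMod m) := Finset.univ.image fun a : (ZMod m)ˣ => (a : ZMod m) with hU
  have hmemU : ∀ s : ZMod m, s.val.Coprime m → s ∈ U := fun s hs => by
    obtain ⟨a, ha⟩ := (coprime_iff_isUnit s).mp hs
    exact Finset.mem_image.mpr ⟨a, Finset.mem_univ _, ha⟩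
  have hsub : T ∪ T.image (fun s : ZMod m => -s) ⊆ U.erase t := by
    intro s hs
    rw [Finset.mem_erase]
    rcases Finset.mem_union.mp hs with h | h
    · exact ⟨fun hst => htT (hst ▸ h), hmemU s (hu s h)⟩
    · obtain ⟨s', hs', rfl⟩ := Finset.mem_image.mp h
      refine ⟨fun hst => hnt ?_, hmemU _ (coprime_val_neg (hu s' hs'))⟩
      rw [← hst, neg_neg]; exact hs'
  have hdis : Disjoint T (T.image fun s : ZMod m => -s) := by
    rw [Finset.disjoint_left]
    intro s hs hs'
    obtain ⟨s', hs'', hss'⟩ := Finset.mem_image.mp hs'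
    exact hdisj s' hs'' (hss'.symm ▸ hs)
  have h1 := Finset.card_le_card hsub
  rw [Finset.card_union_of_disjoint hdis, Finset.card_image_of_injective _ neg_injective,
    Finset.card_erase_of_mem (hmemU t ht), hU, card_image_units] at h1
  have := Nat.totient_pos.mpr (NeZero.pos m)
  omega

omit [NeZero m] in
/-- `i ↦ γ^i (mod m)` is injective on `i < d` as soon as `d ≤ ord γ`.
research route conditional on HC_CM; not a corollary; Q11.4-sentence-2 already refuted in dim ≥ 3. [folklore] -/
theorem coe_pow_injOn (γ : (ZMod m)ˣ) {d : ℕ} (hord : d ≤ orderOf γ) :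
    ∀ i ∈ Finset.range d, ∀ j ∈ Finset.range d,
      ((γ ^ i : (ZMod m)ˣ) : ZMod m) = ((γ ^ j : (ZMod m)ˣ) : ZMod m) → i = j :=
  fun _ hi _ hj hij => pow_injOn_Iio_orderOf (x := γ)
    (Set.mem_Iio.mpr (lt_of_lt_of_le (Finset.mem_range.mp hi) hord))
    (Set.mem_Iio.mpr (lt_of_lt_of_le (Finset.mem_range.mp hj) hord)) (Units.ext hij)

/-- **Half-systems of powers**: for a unit `γ` mod `m` and `d` with `2d = φ(m)`, `d ≤ ord γ` and
`γ^i ≠ −γ^j` for all `i, j < d`, the residues `γ^0, γ^1, …, γ^{d−1}` form a CM type set mod `m`.  (Used with `γ` a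
generator of a cyclic `(ℤ/m)ˣ`, `m ∈ {4, p^a, 2p^a}`, and with `γ = 5`, `m = 2^a`, `d = 2^{a−2}`.)
research route conditional on HC_CM; not a corollary; Q11.4-sentence-2 already refuted in dim ≥ 3. [folklore] -/
theorem isCMTypeSet_image_pow (γ : (ZMod m)ˣ) {d : ℕ} (hd : 2 * d = Nat.totient m) (hord : d ≤ orderOf γ)
    (hneg : ∀ i < d, ∀ j < d, ((γ ^ i : (ZMod m)ˣ) : ZMod m) ≠ -((γ ^ j : (ZMod m)ˣ) : ZMod m)) :
    IsCMTypeSet m ((Finset.range d).image fun i => ((γ ^ i : (ZMod m)ˣ) : ZMod m)) := by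
  refine isCMTypeSet_of_card (fun t ht => ?_) (fun t ht hnt => ?_) ?_
  · obtain ⟨i, -, rfl⟩ := Finset.mem_image.mp ht
    exact ZMod.val_coe_unit_coprime _
  · obtain ⟨i, hi, rfl⟩ := Finset.mem_image.mp ht
    obtain ⟨j, hj, hji⟩ := Finset.mem_image.mp hnt
    refine hneg i (Finset.mem_range.mp hi) j (Finset.mem_range.mp hj) ?_
    rw [hji, neg_neg]
  · rw [Finset.card_image_of_injOn (coe_pow_injOn γ hord), Finset.card_range, hd]

omit [NeZero m] in
/-- The `i`-th member of the half-system of powers, as a natural number `< m`, reduces to `γ^i`; consecutive members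
satisfy `a_i · γ ≡ a_{i+1} (mod m)`.
research route conditional on HC_CM; not a corollary; Q11.4-sentence-2 already refuted in dim ≥ 3. [folklore] -/
theorem val_pow_succ_modEq (γ : (ZMod m)ˣ) (i : ℕ) :
    ((γ ^ i : (ZMod m)ˣ) : ZMod m).val * (γ : ZMod m).val ≡ ((γ ^ (i + 1) : (ZMod m)ˣ) : ZMod m).val [MOD m] := by
  rw [Nat.ModEq, pow_succ, Units.val_mul, ZMod.val_mul, Nat.mod_mod]

end HalfSystems

/-! ### §2 The norm of `K⁺` read on a half-system, and real units of norm `−1` -/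

section Norm

variable {K : Type} [Field K] [NumberField K] [IsCMField K] {n : ℕ} [NeZero n] {ζ : K}

/-- **`N_{K⁺/ℚ}(x) = ∏_{t ∈ T} σ_t(x)`** in `K = ℚ(ζₙ)` for `x ∈ K⁺`, any CM type set `T` mod `n` and the
automorphisms `σ_t : ζ ↦ ζ^t`: the restrictions of the `σ_t`, `t ∈ T`, to `K⁺` are exactly the embeddings of `K⁺`
(part 55 `prod_embedding_algebraMap_eq_norm` for the CM type `Φ` reading `T`, part 62 `prod_embedding_eq_prod_aut`,
injectivity of `φ₁ : K → ℂ`).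
research route conditional on HC_CM; not a corollary; Q11.4-sentence-2 already refuted in dim ≥ 3. [cite: Washington1997, §2, Thm. 2.5] -/
theorem algebraMap_norm_eq_prod_aut [IsCyclotomicExtension {n} ℚ K] (hζ : IsPrimitiveRoot ζ n)
    {T : Finset (ZMod n)} (hT : IsCMTypeSet n T) {σf : ZMod n → (K ≃ₐ[ℚ] K)}
    (hσf : ∀ t : ZMod n, t.val.Coprime n → σf t ζ = ζ ^ t.val) (x : maximalRealSubfield K) :
    algebraMap ℚ K (Algebra.norm ℚ x) = ∏ t ∈ T, σf t (algebraMap (maximalRealSubfield K) K x) := by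
  obtain ⟨Φ, hΦ⟩ := exists_cmType_iff_mem (K := K) hζ hT
  have h1 : (1 : ZMod n).val.Coprime n := by
    rw [ZMod.val_one_eq_one_mod]
    rcases Nat.lt_or_ge 1 n with hn | hn
    · rw [Nat.mod_eq_of_lt hn]; exact Nat.coprime_one_left n
    · have : n = 1 := le_antisymm hn (NeZero.pos n)
      subst this; simp
  obtain ⟨φ₁, hφ₁⟩ := exists_embedding_apply_eq_toCircle hζ 1 h1
  have hprod := prod_embedding_algebraMap_eq_norm Φ x
  rw [prod_embedding_eq_prod_aut hζ hT hΦ hφ₁ hσf] at hprod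
  apply φ₁.injective
  rw [hprod, eq_ratCast (algebraMap ℚ K), map_ratCast, eq_ratCast]

/-- **DESCENT: a real unit with automorphism product `−1` is a unit of `𝓞 K⁺` of norm `−1`.**  If `U ∈ 𝓞 K` is a unit
fixed by complex conjugation and `∏_{t ∈ T} σ_t(U) = −1` in `K` for some CM type set `T`, then `U` is the image of
a unit `v` of `𝓞 K⁺` with `N_{K⁺/ℚ}(v) = −1`.
research route conditional on HC_CM; not a corollary; Q11.4-sentence-2 already refuted in dim ≥ 3. [cite: Washington1997, §2, Thm. 2.5] -/
theorem exists_units_norm_eq_neg_one_of_prod_aut [IsCyclotomicExtension {n} ℚ K] (hζ : IsPrimitiveRoot ζ n)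
    {T : Finset (ZMod n)} (hT : IsCMTypeSet n T) {σf : ZMod n → (K ≃ₐ[ℚ] K)}
    (hσf : ∀ t : ZMod n, t.val.Coprime n → σf t ζ = ζ ^ t.val) {U : 𝓞 K} (hU : IsUnit U)
    (hreal : IsCMField.complexConj K (U : K) = U) (hprod : ∏ t ∈ T, σf t (U : K) = -1) :
    ∃ v : (𝓞 (maximalRealSubfield K))ˣ,
      algebraMap (𝓞 (maximalRealSubfield K)) K (v : 𝓞 (maximalRealSubfield K)) = (U : K) ∧
      Algebra.norm ℚ (((v : 𝓞 (maximalRealSubfield K)) : maximalRealSubfield K)) = -1 := by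
  obtain ⟨v, hv⟩ := (IsCMField.Units.complexConj_eq_self_iff K hU.unit).mp (by
    rw [IsUnit.unit_spec]; exact hreal)
  rw [IsUnit.unit_spec] at hv
  have hv' : algebraMap (𝓞 (maximalRealSubfield K)) K (v : 𝓞 (maximalRealSubfield K)) = (U : K) := by
    rw [hv]
  refine ⟨v, hv', ?_⟩
  have hx : algebraMap (maximalRealSubfield K) K ((v : 𝓞 (maximalRealSubfield K)) : maximalRealSubfield K) =
      (U : K) := by
    rw [← hv', IsScalarTower.algebraMap_apply (𝓞 (maximalRealSubfield K)) (maximalRealSubfield K) K]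
  have h := algebraMap_norm_eq_prod_aut hζ hT hσf ((v : 𝓞 (maximalRealSubfield K)) : maximalRealSubfield K)
  rw [hx, hprod, ← (algebraMap ℚ K).map_one, ← map_neg] at h
  exact (algebraMap ℚ K).injective h

end Norm

/-! ### §3 Complex conjugation on `ζ`, and telescoping products in a field -/

section Zeta

variable {K : Type} [Field K] [NumberField K] [IsCMField K] {n : ℕ} [NeZero n] {ζ : K}

/-- **`ζ^ρ = ζ⁻¹`**: complex conjugation inverts roots of unity (every embedding sends `ζ` to the unit circle).
research route conditional on HC_CM; not a corollary; Q11.4-sentence-2 already refuted in dim ≥ 3. [folklore] -/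
theorem complexConj_eq_inv (hζ : IsPrimitiveRoot ζ n) : IsCMField.complexConj K ζ = ζ⁻¹ := by
  obtain ⟨φ⟩ := (inferInstance : Nonempty (K →+* ℂ))
  apply φ.injective
  rw [IsCMField.complexEmbedding_complexConj, map_inv₀]
  have hn1 : ‖φ ζ‖ = 1 := Complex.norm_eq_one_of_pow_eq_one (by rw [← map_pow, hζ.pow_eq_one, map_one])
    (NeZero.ne n)
  exact (Complex.inv_eq_conj hn1).symm

omit [NumberField K] [IsCMField K] [NeZero n] in
/-- `ζ^k` only depends on `k mod n`.
research route conditional on HC_CM; not a corollary; Q11.4-sentence-2 already refuted in dim ≥ 3. [folklore] -/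
theorem pow_eq_pow_of_modEq (hζ : IsPrimitiveRoot ζ n) {k k' : ℕ} (h : k ≡ k' [MOD n]) : ζ ^ k = ζ ^ k' := by
  rw [pow_eq_pow_mod k hζ.pow_eq_one, pow_eq_pow_mod k' hζ.pow_eq_one, h]

end Zeta

section Telescope

variable {F : Type*} [Field F]

/-- **Telescoping**: `∏_{i<d} f(i+1)/f(i) = f(d)/f(0)` when no `f(i)`, `i ≤ d`, vanishes.
research route conditional on HC_CM; not a corollary; Q11.4-sentence-2 already refuted in dim ≥ 3. [folklore] -/
theorem prod_range_div_telescope (f : ℕ → F) {d : ℕ} (hf : ∀ i ≤ d, f i ≠ 0) :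
    ∏ i ∈ Finset.range d, f (i + 1) / f i = f d / f 0 := by
  induction d with
  | zero => rw [Finset.prod_range_zero, div_self (hf 0 le_rfl)]
  | succ d ih =>
    rw [Finset.prod_range_succ, ih fun i hi => hf i (Nat.le_succ_of_le hi)]
    have h0 := hf 0 (Nat.zero_le _)
    have hd := hf d (Nat.le_succ d)
    field_simp

end Telescope

end Summit.HodgeConjecture.Ring2WeilCoverage.RealUnitNormHalfSystems

end
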